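import Summits.ValiantsHypothesis.ValiantsHypothesis.Theorems.KPlusLogSqLawTropicalBToeplitzPersymmetric

/-!
# Route `KPlusLogSqLaw`, crux `TropicalB` — Toeplitz sector: EVEN instances see only `rev`-commuting involutions

HONEST FRAMING.  Helper toward the registered stubs `stub_tropThin` / `stub_tropFat` of
`Cruxes/TropicalB/Lines/birth.lean` (crux `Summit.ValiantsHypothesis.ValiantsHypothesis.Theses.KPlusLogSqLaw.TropicalB`,
ledger item `stmt-ValiantsHypothesis-19771`, route `KPlusLogSqLaw`; cell `pub-symmetroid`, seat `val-sym-trop-p4` (g22),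
2026-08-29).  A structural constraint on the members of the cell's Conjecture T / Conjecture Q chains
(`Toeplitz.LinearInstanceBound`, `Toeplitz.FixedSlopeInstanceBound`, `Toeplitz.ConjectureQ` of `…ToeplitzConjectureT`) in the
EVEN sub-sector; nothing here bounds `Φ_Toep`, and nothing bears on `TropicalB` for general designs, `KPlusLogSqLaw`,
`MatrixDescartes` or `VP ≠ VNP`.

THE SYMMETRY.  A linear Toeplitz instance is EVEN when its slope and intercept functions and its admissible set are blind to
the SIGN of the displacement: `ψ (−δ) = ψ δ`, `α (−δ) = α δ`, `P δ → P (−δ)` (the quadratic-slope class of Conjecture Q,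
`ψ δ = δ²`, has an even slope function; its even-intercept half is the sub-sector studied here).  Inversion `τ ↦ τ⁻¹` negates
the displacement multiset (`τ⁻¹ (τ b) − τ b = −(τ b − b)`), so for an even instance `τ⁻¹` has the same weight and the same
admissibility as `τ`; a UNIQUE optimum therefore equals its inverse:
* `toeplitz_weight_symm_of_even` — `Σ_b f (τ⁻¹ b − b) = Σ_b f (τ b − b)` for even `f`;
* `toeplitz_even_opt_involutive` — the unique admissible maximiser of an even instance is an INVOLUTION (`τ⁻¹ = τ`,
  pointwise `toeplitz_even_opt_apply_apply`);
* `toeplitz_even_opt_comm_rev` — combined with persymmetry (`toeplitz_opt_symm_rev`, `…ToeplitzPersymmetric`) it COMMUTES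
  with the reversal: `τ (rev x) = rev (τ x)`;
* `toeplitz_weight_eq_sum_natAbs_of_even` — its weight is a function of the UNSIGNED displacements alone.
So in the even sub-sector every chain member is a partial matching of the positions `0 … m−1` (fixed points and 2-cycles)
that is symmetric under `x ↦ m−1−x`, weighted by the multiset of ARC LENGTHS `|τ b − b|` — the even half of Conjecture Q is
a parametric MATCHING count on the path's vertex set with length-dependent arc weights `w(ℓ) + θ·ℓ²` (located, this seat,
hub climbs `m = 5 … 12`: `4, 6, 5, 8, 8, 12, 10, 16` unique optima; the extremal chains are ladder tilings `{(a, a+ℓ)}` of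
increasing shift followed by rainbows — memo HOME/val-sym-trop-p4/g22/CONJQ-g22.md).

References: folklore (inversion symmetry of symmetric assignment instances); `toeplitz_opt_symm_rev` (val-sym-trop-p3,
`…ToeplitzPersymmetric`); the K-class twin for symmetric designs is `isInvolution_of_dominant_symmetric`
(`…TropicalBSymmetricInvolution`, val-sym-trop-p1).
-/

set_option linter.dupNamespace false
set_option autoImplicit false

namespace Summit.ValiantsHypothesis.ValiantsHypothesis.Theorems.KPlusLogSqLaw.Toeplitz

open scoped BigOperators
open Finset

section Even

variable {m : ℕ}

/-- The inverse permutation NEGATES displacements along the re-indexing `b ↦ τ b`: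
`τ⁻¹ (τ b) − τ b = −(τ b − b)`. [folklore] -/
theorem displacement_symm_apply (τ : Equiv.Perm (Fin m)) (b : Fin m) :
    ((τ.symm (τ b) : Fin m) : ℤ) - ((τ b : Fin m) : ℤ) = -(((τ b : Fin m) : ℤ) - (b : ℤ)) := by
  rw [Equiv.symm_apply_apply]; ring

/-- **Even weights are inversion-invariant**: for an even function `f` of the displacement, `τ⁻¹` and `τ` have the same
total weight `Σ_b f (σ b − b)`. [folklore] -/
theorem toeplitz_weight_symm_of_even (f : ℤ → ℤ) (hf : ∀ δ : ℤ, f (-δ) = f δ) (τ : Equiv.Perm (Fin m)) :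
    ∑ b, f ((τ.symm b : ℤ) - b) = ∑ b, f ((τ b : ℤ) - b) := by
  rw [← Equiv.sum_comp τ (fun b => f ((τ.symm b : ℤ) - b))]
  refine sum_congr rfl fun b _ => ?_
  rw [displacement_symm_apply, hf]

/-- Admissibility of the inverse for a sign-symmetric admissible set. [folklore] -/
theorem toeplitz_admissible_symm_of_even (P : ℤ → Prop) (hP : ∀ δ : ℤ, P δ → P (-δ)) (τ : Equiv.Perm (Fin m))
    (hτP : ∀ b, P ((τ b : ℤ) - b)) : ∀ b, P ((τ.symm b : ℤ) - b) := by
  intro b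
  have h := hP _ (hτP (τ.symm b))
  rw [← displacement_symm_apply τ (τ.symm b)] at h
  simpa only [Equiv.apply_symm_apply] using h

/-- **Unique optima of EVEN linear Toeplitz instances are involutions.**  If `ψ`, `α` are even and the admissible set is
sign-symmetric, a permutation `τ` that is the UNIQUE admissible maximiser of `Σ_b (θ·ψ + α)(τ b − b)` satisfies `τ⁻¹ = τ`.
[folklore] -/
theorem toeplitz_even_opt_involutive (ψ α : ℤ → ℤ) (P : ℤ → Prop) (θ : ℤ) (τ : Equiv.Perm (Fin m))
    (hψ : ∀ δ : ℤ, ψ (-δ) = ψ δ) (hα : ∀ δ : ℤ, α (-δ) = α δ) (hP : ∀ δ : ℤ, P δ → P (-δ))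
    (hτP : ∀ b, P ((τ b : ℤ) - b))
    (huniq : ∀ σ : Equiv.Perm (Fin m), σ ≠ τ → (∀ b, P ((σ b : ℤ) - b)) →
      ∑ b, (θ * ψ ((σ b : ℤ) - b) + α ((σ b : ℤ) - b)) < ∑ b, (θ * ψ ((τ b : ℤ) - b) + α ((τ b : ℤ) - b))) :
    τ.symm = τ := by
  by_contra hne
  have hlt := huniq τ.symm hne (toeplitz_admissible_symm_of_even P hP τ hτP)
  have hW := toeplitz_weight_symm_of_even (fun δ => θ * ψ δ + α δ) (fun δ => by simp only [hψ, hα]) τ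
  rw [hW] at hlt
  exact lt_irrefl _ hlt

/-- Pointwise form: `τ (τ b) = b` — every unique optimum of an even instance is a partial matching of the positions
(fixed points and 2-cycles). [folklore] -/
theorem toeplitz_even_opt_apply_apply (ψ α : ℤ → ℤ) (P : ℤ → Prop) (θ : ℤ) (τ : Equiv.Perm (Fin m))
    (hψ : ∀ δ : ℤ, ψ (-δ) = ψ δ) (hα : ∀ δ : ℤ, α (-δ) = α δ) (hP : ∀ δ : ℤ, P δ → P (-δ))
    (hτP : ∀ b, P ((τ b : ℤ) - b))
    (huniq : ∀ σ : Equiv.Perm (Fin m), σ ≠ τ → (∀ b, P ((σ b : ℤ) - b)) →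
      ∑ b, (θ * ψ ((σ b : ℤ) - b) + α ((σ b : ℤ) - b)) < ∑ b, (θ * ψ ((τ b : ℤ) - b) + α ((τ b : ℤ) - b)))
    (b : Fin m) : τ (τ b) = b := by
  have h := toeplitz_even_opt_involutive ψ α P θ τ hψ hα hP hτP huniq
  have hb := congrArg (fun e : Equiv.Perm (Fin m) => e (τ b)) h
  simpa only [Equiv.symm_apply_apply] using hb.symm

/-- **Unique optima of even instances commute with the reversal**: `τ (rev x) = rev (τ x)`.  Persymmetry
(`toeplitz_opt_symm_rev`: `τ⁻¹ (rev x) = rev (τ x)`) together with `τ⁻¹ = τ`.  Hence the matching of an even-instance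
optimum is symmetric under `x ↦ m−1−x`. [folklore] -/
theorem toeplitz_even_opt_comm_rev (ψ α : ℤ → ℤ) (P : ℤ → Prop) (θ : ℤ) (τ : Equiv.Perm (Fin m))
    (hψ : ∀ δ : ℤ, ψ (-δ) = ψ δ) (hα : ∀ δ : ℤ, α (-δ) = α δ) (hP : ∀ δ : ℤ, P δ → P (-δ))
    (hτP : ∀ b, P ((τ b : ℤ) - b))
    (huniq : ∀ σ : Equiv.Perm (Fin m), σ ≠ τ → (∀ b, P ((σ b : ℤ) - b)) →
      ∑ b, (θ * ψ ((σ b : ℤ) - b) + α ((σ b : ℤ) - b)) < ∑ b, (θ * ψ ((τ b : ℤ) - b) + α ((τ b : ℤ) - b)))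
    (x : Fin m) : τ (Fin.rev x) = Fin.rev (τ x) := by
  have hinv := toeplitz_even_opt_involutive ψ α P θ τ hψ hα hP hτP huniq
  have h := toeplitz_opt_symm_rev ψ α P θ τ hτP huniq x
  rwa [hinv] at h

/-- **The weight of an even instance is a function of the UNSIGNED displacements** `|τ b − b|` (the arc lengths of the
matching): `Σ_b f (τ b − b) = Σ_b f |τ b − b|` for even `f`. [folklore] -/
theorem toeplitz_weight_eq_sum_natAbs_of_even (f : ℤ → ℤ) (hf : ∀ δ : ℤ, f (-δ) = f δ) (τ : Equiv.Perm (Fin m)) :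
    ∑ b, f ((τ b : ℤ) - b) = ∑ b, f (((τ b : ℤ) - b).natAbs : ℤ) := by
  refine sum_congr rfl fun b _ => ?_
  rcases Int.natAbs_eq ((τ b : ℤ) - b) with h | h
  · rw [← h]
  · conv_lhs => rw [h]
    rw [hf]

end Even

end Summit.ValiantsHypothesis.ValiantsHypothesis.Theorems.KPlusLogSqLaw.Toeplitz
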